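import Summits.ABC.ABC.Theorems.TwistAmplificationMazurKaneLawRecordFineDefs

/-!
# Crux `TwistAmplification.MazurKaneLaw` (stmt-ABC-2757), line `critical-kloosterman-powerful-moduli`: the record pipeline with the
# DE family (record pipeline v3)

Two naming definitions for the certified sub-Kane records of lead c4 (the dispersion/energy tool `dispersion_linear`,
`…DEDictEntry.lean`), pattern `…RecordDefs.lean` / `…RecordFineDefs.lean`:

* `LpCertDE K J s₀ Vc` — the PURE-REAL LP statement in `J` explicit levels: the telescope of `recordInstanceK_of_lp`
  (structure, radical budget `A + B + C ≤ s₀ + σ`, the five tool families of the fibre toolkit) PLUS the three DE families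
  (hosts `a`, `b`, `c`; pivot levels `i₀ = 0`, `i₁ = 1`; level set `Q`; the eight disjuncts are verbatim the conclusion of
  `dispersion_linear` divided by `2`, the loss absorbed in `σ`), with conclusion `D ≤ Vc + K·σ`. The generated certificate files
  `…RecordLPDE*.lean` prove `LpCertDE 3 4 s₀ ((2 + s₀)/4)` for `16/9 ≤ s₀ ≤ 2` (through the bundle `LpHypsDE4` and an adapter).
* `RecordInstanceDE K J s₀ Vc` — verbatim `RecordInstanceK K J s₀ Vc` except that the divisor hypothesis is asked up to `8·T³`
  (`∀ m ≠ 0, m ≤ 8 T³ → τ(m) ≤ Dτ`) instead of `T`: the DE tool counts solutions of `A² C ≡ B² D` with products of size `≤ 8 T³`.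
  The DE dictionary theorem proves `LpCertDE K J s₀ Vc → RecordInstanceDE K J s₀ Vc`; the DE endgame evaluates it with
  `Dτ := ⌊C_τ (8 T³)^κ⌋` and yields the shape-count bound consumed by `recordAt_of_shapeBound`.

Nothing is proved here beyond the registration lemma `recordInstanceDE_of_recordInstanceK` (the stronger divisor hypothesis makes
`RecordInstanceDE` the weaker fact).
-/

noncomputable section

-- `Summit.<Summit>.<Problem>` is the mandated summit-side namespace; the duplicate `ABC.ABC` is deliberate (single-conjunct summit).
set_option linter.dupNamespace false

open Finset
open Literature.NumberTheory.DiophantineGeometry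
open Literature.NumberTheory.DiophantineGeometry.AbcShapes

namespace Summit.ABC.ABC.Theorems.MazurKaneLaw.Toolkit

/-- THE LP CERTIFICATE STATEMENT WITH THE DE FAMILY, `J` explicit levels, slack coefficient `K`, radical exponent `s₀`, value `Vc`:
for all nonnegative level exponents `a b c : Fin J → ℝ` and totals `A B C`, count exponent `D`, defects `da db dc` and slack `σ`
satisfying the structure hypotheses, the radical budget `A + B + C ≤ s₀ + σ`, the trivial / subset-geometry / Fourier / determinant /
square-root-lattice families and the three DE families (hosts `a`, `b`, `c`), one has `D ≤ Vc + K σ`. -/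
def LpCertDE (K : ℝ) (J : ℕ) (s₀ Vc : ℝ) : Prop :=
∀ (a b c : Fin J → ℝ) (A B C D da db dc σ : ℝ),
      (∀ k, 0 ≤ a k) → (∀ k, 0 ≤ b k) → (∀ k, 0 ≤ c k) →
      ∑ k, a k ≤ A → ∑ k, b k ≤ B → ∑ k, c k ≤ C →
      ((J : ℝ) + 1) * A - ∑ k : Fin J, ((J : ℝ) - ((k : ℕ) : ℝ)) * a k ≤ 1 - da → 0 ≤ da → da ≤ 1 →
      ((J : ℝ) + 1) * B - ∑ k : Fin J, ((J : ℝ) - ((k : ℕ) : ℝ)) * b k ≤ 1 - db → 0 ≤ db → db ≤ 1 →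
      ((J : ℝ) + 1) * C - ∑ k : Fin J, ((J : ℝ) - ((k : ℕ) : ℝ)) * c k ≤ 1 - dc → 0 ≤ dc → dc ≤ σ →
      0 ≤ σ → σ ≤ 1 / 1000 → A + B + C ≤ s₀ + σ →
      D ≤ A + B + σ → D ≤ A + C + σ → D ≤ B + C + σ →
      (∀ k : Fin J, 1 ≤ (k : ℕ) →
        D ≤ A + B + C - (a k + b k + c k) + σ ∨
        D ≤ A + B + C - 1 + ((((k : ℕ) : ℝ) - 1) * (a k + b k + c k) + (da + db + dc)) / 3 + σ) →
      (∀ (SU SV SW : Finset (Fin J)) (eU eV eW : ℕ), 2 ≤ eU → 2 ≤ eV → 2 ≤ eW →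
        (∀ k ∈ SU, eU ∣ (k : ℕ) + 1) → (∀ k ∈ SV, eV ∣ (k : ℕ) + 1) → (∀ k ∈ SW, eW ∣ (k : ℕ) + 1) →
        ∑ k ∈ SU, a k + ∑ k ∈ SV, b k + ∑ k ∈ SW, c k ≤ 4 * (A + B + C) - 6 * D + σ) →
      (∀ (I J' K : Finset (Fin J)),
        ∑ k ∈ I, a k + ∑ k ∈ J', b k + ∑ k ∈ K, c k ≤ A + B + C - D + σ ∨
        1 - (∑ k ∈ I, ((k : ℕ) : ℝ) * a k + ∑ k ∈ J', ((k : ℕ) : ℝ) * b k + ∑ k ∈ K, ((k : ℕ) : ℝ) * c k) ≤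
          A + B + C - D + σ) →
      (∀ (H : Finset (Fin J)) (k : Fin J), 1 ≤ (k : ℕ) →
        D ≤ A + B + C - (1 - da) + ∑ j ∈ H, ((j : ℕ) : ℝ) * a j + σ ∨
        D ≤ A + B + C - (∑ j ∈ H, a j + b k + c k) + σ) →
      (∀ (H : Finset (Fin J)) (k : Fin J), 1 ≤ (k : ℕ) →
        D ≤ A + B + C - (1 - db) + ∑ j ∈ H, ((j : ℕ) : ℝ) * b j + σ ∨
        D ≤ A + B + C - (∑ j ∈ H, b j + a k + c k) + σ) →
      (∀ (H : Finset (Fin J)) (k : Fin J), 1 ≤ (k : ℕ) →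
        D ≤ A + B + C - (1 - dc) + ∑ j ∈ H, ((j : ℕ) : ℝ) * c j + σ ∨
        D ≤ A + B + C - (∑ j ∈ H, c j + a k + b k) + σ) →
      (∀ (i₀ i₁ : Fin J), (i₀ : ℕ) = 0 → (i₁ : ℕ) = 1 → ∀ (Q : Finset (Fin J)),
        D ≤ ((b i₀ + c i₀) + 0 + ∑ j ∈ Q, a j + (∑ j ∈ Q, a j + 2 * ((B - b i₀ - b i₁) + (C - c i₀ - c i₁)) + 2 * (b i₁ + c i₁) - ∑ j ∈ Q, (((j : ℕ) : ℝ) + 1) * a j)) / 2 + σ ∨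
        D ≤ ((b i₀ + c i₀) + 0 + ∑ j ∈ Q, a j + (∑ j ∈ Q, a j + 2 * ((B - b i₀ - b i₁) + (C - c i₀ - c i₁)))) / 2 + σ ∨
        D ≤ ((b i₀ + c i₀) + 0 + ∑ j ∈ Q, a j + ((b i₁ + c i₁) + ∑ j ∈ Q, a j + ((B - b i₀ - b i₁) + (C - c i₀ - c i₁)))) / 2 + σ ∨
        D ≤ ((b i₀ + c i₀) + 0 + ∑ j ∈ Q, a j + ((b i₁ + c i₁) + 2 * ((B - b i₀ - b i₁) + (C - c i₀ - c i₁)) + (∑ j ∈ Q, a j) / 2)) / 2 + σ ∨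
        D ≤ ((b i₀ + c i₀) + ((b i₀ + c i₀) - ∑ j ∈ Q, (((j : ℕ) : ℝ) + 1) * a j) + ∑ j ∈ Q, a j + (∑ j ∈ Q, a j + 2 * ((B - b i₀ - b i₁) + (C - c i₀ - c i₁)) + 2 * (b i₁ + c i₁) - ∑ j ∈ Q, (((j : ℕ) : ℝ) + 1) * a j)) / 2 + σ ∨
        D ≤ ((b i₀ + c i₀) + ((b i₀ + c i₀) - ∑ j ∈ Q, (((j : ℕ) : ℝ) + 1) * a j) + ∑ j ∈ Q, a j + (∑ j ∈ Q, a j + 2 * ((B - b i₀ - b i₁) + (C - c i₀ - c i₁)))) / 2 + σ ∨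
        D ≤ ((b i₀ + c i₀) + ((b i₀ + c i₀) - ∑ j ∈ Q, (((j : ℕ) : ℝ) + 1) * a j) + ∑ j ∈ Q, a j + ((b i₁ + c i₁) + ∑ j ∈ Q, a j + ((B - b i₀ - b i₁) + (C - c i₀ - c i₁)))) / 2 + σ ∨
        D ≤ ((b i₀ + c i₀) + ((b i₀ + c i₀) - ∑ j ∈ Q, (((j : ℕ) : ℝ) + 1) * a j) + ∑ j ∈ Q, a j + ((b i₁ + c i₁) + 2 * ((B - b i₀ - b i₁) + (C - c i₀ - c i₁)) + (∑ j ∈ Q, a j) / 2)) / 2 + σ) →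
      (∀ (i₀ i₁ : Fin J), (i₀ : ℕ) = 0 → (i₁ : ℕ) = 1 → ∀ (Q : Finset (Fin J)),
        D ≤ ((a i₀ + c i₀) + 0 + ∑ j ∈ Q, b j + (∑ j ∈ Q, b j + 2 * ((A - a i₀ - a i₁) + (C - c i₀ - c i₁)) + 2 * (a i₁ + c i₁) - ∑ j ∈ Q, (((j : ℕ) : ℝ) + 1) * b j)) / 2 + σ ∨
        D ≤ ((a i₀ + c i₀) + 0 + ∑ j ∈ Q, b j + (∑ j ∈ Q, b j + 2 * ((A - a i₀ - a i₁) + (C - c i₀ - c i₁)))) / 2 + σ ∨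
        D ≤ ((a i₀ + c i₀) + 0 + ∑ j ∈ Q, b j + ((a i₁ + c i₁) + ∑ j ∈ Q, b j + ((A - a i₀ - a i₁) + (C - c i₀ - c i₁)))) / 2 + σ ∨
        D ≤ ((a i₀ + c i₀) + 0 + ∑ j ∈ Q, b j + ((a i₁ + c i₁) + 2 * ((A - a i₀ - a i₁) + (C - c i₀ - c i₁)) + (∑ j ∈ Q, b j) / 2)) / 2 + σ ∨
        D ≤ ((a i₀ + c i₀) + ((a i₀ + c i₀) - ∑ j ∈ Q, (((j : ℕ) : ℝ) + 1) * b j) + ∑ j ∈ Q, b j + (∑ j ∈ Q, b j + 2 * ((A - a i₀ - a i₁) + (C - c i₀ - c i₁)) + 2 * (a i₁ + c i₁) - ∑ j ∈ Q, (((j : ℕ) : ℝ) + 1) * b j)) / 2 + σ ∨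
        D ≤ ((a i₀ + c i₀) + ((a i₀ + c i₀) - ∑ j ∈ Q, (((j : ℕ) : ℝ) + 1) * b j) + ∑ j ∈ Q, b j + (∑ j ∈ Q, b j + 2 * ((A - a i₀ - a i₁) + (C - c i₀ - c i₁)))) / 2 + σ ∨
        D ≤ ((a i₀ + c i₀) + ((a i₀ + c i₀) - ∑ j ∈ Q, (((j : ℕ) : ℝ) + 1) * b j) + ∑ j ∈ Q, b j + ((a i₁ + c i₁) + ∑ j ∈ Q, b j + ((A - a i₀ - a i₁) + (C - c i₀ - c i₁)))) / 2 + σ ∨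
        D ≤ ((a i₀ + c i₀) + ((a i₀ + c i₀) - ∑ j ∈ Q, (((j : ℕ) : ℝ) + 1) * b j) + ∑ j ∈ Q, b j + ((a i₁ + c i₁) + 2 * ((A - a i₀ - a i₁) + (C - c i₀ - c i₁)) + (∑ j ∈ Q, b j) / 2)) / 2 + σ) →
      (∀ (i₀ i₁ : Fin J), (i₀ : ℕ) = 0 → (i₁ : ℕ) = 1 → ∀ (Q : Finset (Fin J)),
        D ≤ ((a i₀ + b i₀) + 0 + ∑ j ∈ Q, c j + (∑ j ∈ Q, c j + 2 * ((A - a i₀ - a i₁) + (B - b i₀ - b i₁)) + 2 * (a i₁ + b i₁) - ∑ j ∈ Q, (((j : ℕ) : ℝ) + 1) * c j)) / 2 + σ ∨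
        D ≤ ((a i₀ + b i₀) + 0 + ∑ j ∈ Q, c j + (∑ j ∈ Q, c j + 2 * ((A - a i₀ - a i₁) + (B - b i₀ - b i₁)))) / 2 + σ ∨
        D ≤ ((a i₀ + b i₀) + 0 + ∑ j ∈ Q, c j + ((a i₁ + b i₁) + ∑ j ∈ Q, c j + ((A - a i₀ - a i₁) + (B - b i₀ - b i₁)))) / 2 + σ ∨
        D ≤ ((a i₀ + b i₀) + 0 + ∑ j ∈ Q, c j + ((a i₁ + b i₁) + 2 * ((A - a i₀ - a i₁) + (B - b i₀ - b i₁)) + (∑ j ∈ Q, c j) / 2)) / 2 + σ ∨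
        D ≤ ((a i₀ + b i₀) + ((a i₀ + b i₀) - ∑ j ∈ Q, (((j : ℕ) : ℝ) + 1) * c j) + ∑ j ∈ Q, c j + (∑ j ∈ Q, c j + 2 * ((A - a i₀ - a i₁) + (B - b i₀ - b i₁)) + 2 * (a i₁ + b i₁) - ∑ j ∈ Q, (((j : ℕ) : ℝ) + 1) * c j)) / 2 + σ ∨
        D ≤ ((a i₀ + b i₀) + ((a i₀ + b i₀) - ∑ j ∈ Q, (((j : ℕ) : ℝ) + 1) * c j) + ∑ j ∈ Q, c j + (∑ j ∈ Q, c j + 2 * ((A - a i₀ - a i₁) + (B - b i₀ - b i₁)))) / 2 + σ ∨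
        D ≤ ((a i₀ + b i₀) + ((a i₀ + b i₀) - ∑ j ∈ Q, (((j : ℕ) : ℝ) + 1) * c j) + ∑ j ∈ Q, c j + ((a i₁ + b i₁) + ∑ j ∈ Q, c j + ((A - a i₀ - a i₁) + (B - b i₀ - b i₁)))) / 2 + σ ∨
        D ≤ ((a i₀ + b i₀) + ((a i₀ + b i₀) - ∑ j ∈ Q, (((j : ℕ) : ℝ) + 1) * c j) + ∑ j ∈ Q, c j + ((a i₁ + b i₁) + 2 * ((A - a i₀ - a i₁) + (B - b i₀ - b i₁)) + (∑ j ∈ Q, c j) / 2)) / 2 + σ) →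
      D ≤ Vc + K * σ

/-- THE RECORD-INSTANCE FACT FOR THE DE PIPELINE: verbatim `RecordInstanceK K J s₀ Vc` (shape data in dimension `J + e`, standing
hypotheses of the exponent dictionary, level `C₀ ≥ 1`, radical exponent `t`, `B > 0`, determinant tool beyond `P₀ ≥ 1`, the two
square-root lattice tools, slack `σ = recordSlack J (J+e) (2C₀) Dτ P₀ t s₀ ≤ 1/1000`, conclusion `log_{2C₀} B ≤ Vc + K σ`) except that
the divisor bound `τ(m) ≤ Dτ` is required for all `0 < m ≤ 8 T³` (the range of the products counted by the DE tool). -/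
def RecordInstanceDE (K : ℝ) (J : ℕ) (s₀ Vc : ℝ) : Prop :=
  ∀ {e : ℕ} {c₁ c₂ c₃ C₀ : ℕ}, 0 < c₁ → 0 < c₂ → 0 < c₃ → 1 ≤ C₀ →
  ∀ {X Y Z : Fin (J + e) → ℕ}, (∀ i, 0 < X i) → (∀ i, 0 < Y i) → (∀ i, 0 < Z i) →
  ∀ {T Dτ : ℕ}, c₁ * shapeVal (fun i => 2 * X i) ≤ T → c₂ * shapeVal (fun i => 2 * Y i) ≤ T →
    c₃ * shapeVal (fun i => 2 * Z i) ≤ T → (∀ m : ℕ, m ≠ 0 → m ≤ 8 * T ^ 3 → m.divisors.card ≤ Dτ) →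
  C₀ ≤ shapeVal (fun _ : Fin (J + e) => 2) * (c₃ * shapeVal Z) →
  c₁ * shapeVal X ≤ 2 * C₀ → c₂ * shapeVal Y ≤ 2 * C₀ → c₃ * shapeVal Z ≤ 2 * C₀ →
  ∀ {t : ℝ}, (∏ i, ((X i : ℝ) * Y i * Z i)) ≤ (2 * C₀ : ℝ) ^ t →
  0 < shapeCount c₁ c₂ c₃ X Y Z →
  ∀ {P₀ : ℝ}, 1 ≤ P₀ →
  (∀ i : Fin (J + e), 1 ≤ (i : ℕ) → ∀ P : ℝ, P₀ ≤ P →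
    48 * ((X i : ℝ) * Y i * Z i) ≤
      ((c₁ * offVal ({i} : Finset (Fin (J + e))) X : ℕ) : ℝ) * ((c₂ * offVal ({i} : Finset (Fin (J + e))) Y : ℕ) : ℝ) *
        ((c₃ * offVal ({i} : Finset (Fin (J + e))) Z : ℕ) : ℝ) * P ^ 3 →
    (shapeCount c₁ c₂ c₃ X Y Z : ℝ) ≤
      ((subBox ({i} : Finset (Fin (J + e))) X).card * (subBox ({i} : Finset (Fin (J + e))) Y).card *
          (subBox ({i} : Finset (Fin (J + e))) Z).card : ℕ) *
        (Dτ : ℝ) ^ (3 * ((i : ℕ) + 2)) * (24 * ((((i : ℕ) : ℝ) + 1) * (((i : ℕ) : ℝ) + 2))) * P) →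
  Summit.ABC.ABC.Theorems.MazurKaneLaw.Toolkit.SqrtLatticeToolX → Summit.ABC.ABC.Theorems.MazurKaneLaw.Toolkit.SqrtLatticeToolZ →
  Summit.ABC.ABC.Theorems.MazurKaneLaw.Toolkit.recordSlack J (J + e) (2 * C₀) Dτ P₀ t s₀ ≤ 1 / 1000 →
    Real.logb (2 * C₀) (shapeCount c₁ c₂ c₃ X Y Z) ≤ Vc + K * Summit.ABC.ABC.Theorems.MazurKaneLaw.Toolkit.recordSlack J (J + e) (2 * C₀) Dτ P₀ t s₀

/-- Sanity/registration lemma (registered sub-goal `recordInstanceDE_of_recordInstanceK` of crux stmt-ABC-2757, stated verbatim):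
the DE record instance asks a STRONGER divisor hypothesis (up to `8 T³ ≥ T`), so it follows from `RecordInstanceK`. -/
theorem recordInstanceDE_of_recordInstanceK : ∀ (K : ℝ) (J : ℕ) (s₀ Vc : ℝ), Summit.ABC.ABC.Theorems.MazurKaneLaw.Toolkit.RecordInstanceK K J s₀ Vc → Summit.ABC.ABC.Theorems.MazurKaneLaw.Toolkit.RecordInstanceDE K J s₀ Vc := by
  intro K J s₀ Vc h e c₁ c₂ c₃ C₀ hc₁ hc₂ hc₃ hC₀ X Y Z hX hY hZ T Dτ hTX hTY hTZ hD
  refine h hc₁ hc₂ hc₃ hC₀ hX hY hZ hTX hTY hTZ fun m hm hmT => hD m hm (hmT.trans ?_)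
  have hT : 1 ≤ T := by
    rcases Nat.eq_zero_or_pos T with h0 | h0
    · exact absurd (Nat.le_zero.mp (h0 ▸ hmT.trans (le_refl T))) hm
    · exact h0
  calc T = T * 1 * 1 := by ring
    _ ≤ T * T * T := by gcongr
    _ = T ^ 3 := by ring
    _ ≤ 8 * T ^ 3 := Nat.le_mul_of_pos_left _ (by norm_num)

end Summit.ABC.ABC.Theorems.MazurKaneLaw.Toolkit
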